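import Mathlib.Geometry.Manifold.Instances.Sphere
import Mathlib.Geometry.Manifold.SmoothEmbedding
import Literature.Topology.FourManifolds.ImmersionCriterion

/-!
# Vocabulary of the line `shadow-pleats` for crux `OrigamiFoldExistence`
(item stmt-SmoothPoincare4-7844, route route-SmoothPoincare4-SymplecticOrigami)

Route-posited objects of the line (planner skeleton `Cruxes/OrigamiFoldExistence/Lines/shadow-pleats.lean`,
sha 28f26cc3…; triage r1-2 / r1-3 PASS; disprover audit Disproof.lean §7c "no leak either way"), landed
once here so that the stub files `SymplecticOrigamiOrigamiFoldExistenceStub*.lean` and the lead's skeleton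
state the six registered stubs over ONE tree definition each.  Bodies are VERBATIM the skeleton's, with its
local notations `E4 := EuclideanSpace ℝ (Fin 4)`, `E5 := EuclideanSpace ℝ (Fin 5)`,
`𝕊⁴ := Metric.sphere (0 : EuclideanSpace ℝ (Fin 5)) 1` expanded.

* `proj5` — the SHADOW `ℂ² × ℝ → ℂ²` (forget the height coordinate `p 4`);
* `pleatSpheres` — the two FOLD SPHERES (radii `1`, `2`) of a pleat chart `ℝ⁴ ↪ M`;
* `IsFoldPointAt G u` — Whitney fold point of `G : ℝ⁴ → ℝ⁴` (non-zero kernel vector `v` with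
  `D²G(u)[v,v] ∉ range dG(u)`), written with `fderiv`;
* `IsPleatedPosition ι δ e` — a PLEATED ROUND-RIM SHADOW POSITION of `M` in `ℝ⁵` with `k` pleat charts:
  `ι` a `C^∞` embedding, round part `range ι ∩ {h ≤ 1 - δ} = S⁴ ∩ {h ≤ 1 - δ}` (`0 < δ < 1`), pleat
  charts above the plane with pairwise disjoint fold spheres, shadow immersive above the plane off the
  fold spheres, fold at every fold-sphere point;
* `HasPleatedPosition M k` — `∃ ι δ e, IsPleatedPosition ι δ e`.

Non-vacuity certificates (sorry-free, not stubs): `ModelFold.isFoldPointAt_modelFold` (Whitney's model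
fold `u ↦ (u₀², u₁, u₂, u₃)` is a fold point — the skeleton's own certificate) and
`hasPleatedPosition_sphere_zero : HasPleatedPosition S⁴ 0` (the round sphere IS in pleat-free position,
`δ = 1/2`; the skeleton's refuter test `RoundSphereIsPleatFree`, ported from the disprover's proof for a
verbatim copy, Disproof.lean §7c `ShadowPleats.roundSphereIsPleatFree`).

Deliberately NOT here: the six stub statements (they are stated verbatim in the skeleton and in the stub
files over these definitions) and any claim about pleat numbers.
-/

noncomputable section

-- the prescribed namespace `Summit.<P>.<Sub>.…` duplicates `SmoothPoincare4` (P = Sub)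
set_option linter.dupNamespace false

open scoped Manifold ContDiff Topology
open Set Function

namespace Summit.SmoothPoincare4.SmoothPoincare4.Theorems.OrigamiFoldExistence.ShadowPleats

/-! ### Vocabulary (plain definitions over Mathlib; no new objects are posited) -/

/-- The SHADOW: vertical projection `ℂ² × ℝ → ℂ²`, forgetting the height `p 4`.  For an embedding
`ι : M ↪ ℝ⁵` the shadow map is `proj5 ∘ ι : M → ℝ⁴`; its singular points are the vertical
tangencies of `ι(M)` (`∂_h ∈ Tι(M)`), and the kernel there is automatically one-dimensional
(`ker d(proj5 ∘ ι) = dι⁻¹(ℝ ∂_h)`).  (Line `shadow-pleats`, skeleton vocabulary, verbatim.) -/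
def proj5 (p : EuclideanSpace ℝ (Fin 5)) : EuclideanSpace ℝ (Fin 4) :=
  WithLp.toLp 2 ![p 0, p 1, p 2, p 3]

/-- The two FOLD SPHERES of a pleat chart: the round spheres of radii `1` and `2` in the model
`ℝ⁴` of the chart (so the pleat's annulus is the shell `1 ≤ |u| ≤ 2 ≅ S³ × I` and its hole is the
unit ball — both standard by construction).  (Line `shadow-pleats`, skeleton vocabulary, verbatim.) -/
def pleatSpheres : Set (EuclideanSpace ℝ (Fin 4)) :=
  Metric.sphere (0 : EuclideanSpace ℝ (Fin 4)) 1 ∪ Metric.sphere (0 : EuclideanSpace ℝ (Fin 4)) 2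

/-- `u` is a FOLD POINT of the smooth map `G : ℝ⁴ → ℝ⁴` (Whitney): `dG(u)` has a non-zero kernel
vector `v` and the INTRINSIC SECOND DERIVATIVE `ker × ker → coker`,
`(v, v) ↦ D²G(u)[v, v] mod range dG(u)`, is non-zero.  Coordinate-free; for a corank-one germ it is
exactly the fold condition (`γ_tt(0) ≠ 0` in adapted coordinates `G(t, y) = (γ(t, y), y)`); for the
shadow of a hypersurface `Σ ⊂ ℝ⁴ × ℝ` at a vertical tangency it is `II(∂_h, ∂_h) ≠ 0`.  Degenerate
junk is excluded: if `G` is not differentiable at `u` then `fderiv = 0`, the second derivative is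
`0 ∈ range`, and the predicate is FALSE.  (Line `shadow-pleats`, skeleton vocabulary, verbatim.) -/
def IsFoldPointAt (G : EuclideanSpace ℝ (Fin 4) → EuclideanSpace ℝ (Fin 4))
    (u : EuclideanSpace ℝ (Fin 4)) : Prop :=
  ∃ v : EuclideanSpace ℝ (Fin 4), v ≠ 0 ∧ fderiv ℝ G u v = 0 ∧
    fderiv ℝ (fun w => fderiv ℝ G w v) u v ∉ LinearMap.range (fderiv ℝ G u).toLinearMap

/-- A PLEATED ROUND-RIM SHADOW POSITION of `M` in `ℝ⁵ = ℂ² × ℝ` with `k` pleats.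
* `ι : M → ℝ⁵` is a `C^∞` embedding;
* ROUND PART: `0 < δ < 1` and `range ι ∩ {h ≤ 1 - δ} = S⁴ ∩ {h ≤ 1 - δ}` — below the plane
  `h = 1 - δ` the image IS the round unit sphere (lower sheet, equatorial fold `h = 0`, and the
  graphical band up to the polar circle of radius `√(2δ - δ²)`), and nothing else of `ι(M)` reaches
  down to that closed half-space;
* PLEAT CHARTS: each `e j : ℝ⁴ → M` is a smooth embedding of the whole model space landing strictly
  above the plane; its fold spheres `e j '' pleatSpheres` are disjoint from those of the other pleats
  (nesting in another pleat's annulus or hole is allowed);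
* SHADOW: `proj5 ∘ ι` has injective differential at every point above the plane off the fold
  spheres, and a FOLD (`IsFoldPointAt`, in the chart `e j`) at every point of every fold sphere.
(Line `shadow-pleats`, skeleton vocabulary, verbatim with notations expanded.) -/
def IsPleatedPosition {M : Type} [TopologicalSpace M] [ChartedSpace (EuclideanSpace ℝ (Fin 4)) M]
    (ι : M → EuclideanSpace ℝ (Fin 5)) (δ : ℝ) {k : ℕ} (e : Fin k → EuclideanSpace ℝ (Fin 4) → M) :
    Prop :=
  Manifold.IsSmoothEmbedding (𝓡 4) (𝓡 5) ∞ ι ∧ 0 < δ ∧ δ < 1 ∧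
    Set.range ι ∩ {p : EuclideanSpace ℝ (Fin 5) | p 4 ≤ 1 - δ} =
      (Metric.sphere (0 : EuclideanSpace ℝ (Fin 5)) 1 : Set (EuclideanSpace ℝ (Fin 5))) ∩
        {p : EuclideanSpace ℝ (Fin 5) | p 4 ≤ 1 - δ} ∧
    (∀ j, Manifold.IsSmoothEmbedding (𝓡 4) (𝓡 4) ∞ (e j) ∧
      ∀ u : EuclideanSpace ℝ (Fin 4), 1 - δ < ι (e j u) 4) ∧
    Pairwise (Function.onFun Disjoint fun j => e j '' pleatSpheres) ∧
    (∀ m : M, 1 - δ < ι m 4 → m ∉ (⋃ j, e j '' pleatSpheres) →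
      Function.Injective (mfderiv (𝓡 4) (𝓡 4) (proj5 ∘ ι) m)) ∧
    (∀ j, ∀ u ∈ pleatSpheres, IsFoldPointAt (proj5 ∘ ι ∘ e j) u)

/-- `M` admits a pleated round-rim shadow position with (exactly) `k` pleat charts.  The PLEAT
NUMBER `p(M)` of the idea card is the least such `k` (not needed as a definition: the stubs are
implications between these existence statements).  (Line `shadow-pleats`, skeleton vocabulary.) -/
def HasPleatedPosition (M : Type) [TopologicalSpace M] [ChartedSpace (EuclideanSpace ℝ (Fin 4)) M]
    (k : ℕ) : Prop :=
  ∃ (ι : M → EuclideanSpace ℝ (Fin 5)) (δ : ℝ) (e : Fin k → EuclideanSpace ℝ (Fin 4) → M),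
    IsPleatedPosition ι δ e

/-! ### Non-vacuity of the fold clause (PROVED): Whitney's model fold `u ↦ (u₀², u₁, u₂, u₃)`
satisfies `IsFoldPointAt` at the origin, with kernel vector `e₀`, `D²G(0)[e₀, e₀] = 2e₀ ∉
range dG(0) = {x | x 0 = 0}` (the skeleton's own certificate, verbatim). -/

namespace ModelFold

/-- The first basis vector `e₀` of `ℝ⁴`. -/
def e0 : EuclideanSpace ℝ (Fin 4) := EuclideanSpace.single (0 : Fin 4) (1 : ℝ)

/-- The coordinate `u ↦ u 0` as a continuous linear map. -/
def p0 : EuclideanSpace ℝ (Fin 4) →L[ℝ] ℝ := EuclideanSpace.proj (0 : Fin 4)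

/-- The linear part `h ↦ h - (h 0) • e₀` (zero out the first coordinate). -/
def Alin : EuclideanSpace ℝ (Fin 4) →L[ℝ] EuclideanSpace ℝ (Fin 4) :=
  ContinuousLinearMap.id ℝ (EuclideanSpace ℝ (Fin 4)) - p0.smulRight e0

/-- The MODEL FOLD `u ↦ (u₀², u₁, u₂, u₃)`, written as `Alin u + (u 0)² • e₀`. -/
def modelFold (u : EuclideanSpace ℝ (Fin 4)) : EuclideanSpace ℝ (Fin 4) :=
  Alin u + (p0 u * p0 u) • e0

/-- `p0 u = u 0` by definition. -/
@[simp] lemma p0_apply (u : EuclideanSpace ℝ (Fin 4)) : p0 u = u 0 := rfl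

/-- `e₀ 0 = 1`. -/
@[simp] lemma e0_apply_zero : e0 0 = 1 := by simp [e0]

/-- `p0 e₀ = 1`. -/
@[simp] lemma p0_e0 : p0 e0 = 1 := by simp [p0, e0]

/-- `Alin` kills `e₀`. -/
lemma Alin_e0 : Alin e0 = 0 := by
  simp [Alin, ContinuousLinearMap.smulRight_apply]

/-- The derivative of the model fold: `dG(u) h = Alin h + 2 u₀ h₀ • e₀`. [folklore] -/
lemma hasFDerivAt_modelFold (u : EuclideanSpace ℝ (Fin 4)) :
    HasFDerivAt modelFold (Alin + ((p0 u) • p0 + (p0 u) • p0).smulRight e0) u := by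
  have hp : HasFDerivAt (fun w : EuclideanSpace ℝ (Fin 4) => p0 w) p0 u := p0.hasFDerivAt
  have hq : HasFDerivAt (fun w : EuclideanSpace ℝ (Fin 4) => p0 w * p0 w)
      ((p0 u) • p0 + (p0 u) • p0) u := hp.mul hp
  exact Alin.hasFDerivAt.add (hq.smul_const e0)

/-- The Fréchet derivative of the model fold, as an equation. [folklore] -/
lemma fderiv_modelFold (u : EuclideanSpace ℝ (Fin 4)) :
    fderiv ℝ modelFold u = Alin + ((p0 u) • p0 + (p0 u) • p0).smulRight e0 :=
  (hasFDerivAt_modelFold u).fderiv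

/-- **The fold clause is non-vacuous**: Whitney's model fold is a fold point of `IsFoldPointAt`.
[folklore] -/
theorem isFoldPointAt_modelFold : IsFoldPointAt modelFold 0 := by
  refine ⟨e0, ?_, ?_, ?_⟩
  · intro h
    have := congrArg (fun v : EuclideanSpace ℝ (Fin 4) => v 0) h
    simp at this
  · rw [fderiv_modelFold]
    simp [Alin_e0]
  · -- `w ↦ dG(w) e₀` is the linear map `w ↦ (2 w₀) • e₀`, whose derivative at `0` sends `e₀ ↦ 2 • e₀`
    have hfun : (fun w : EuclideanSpace ℝ (Fin 4) => fderiv ℝ modelFold w e0) =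
        fun w => ((2 : ℝ) • p0).smulRight e0 w := by
      funext w
      rw [fderiv_modelFold]
      simp [Alin_e0, ContinuousLinearMap.smulRight_apply, two_smul, add_smul]
    rw [hfun, ContinuousLinearMap.fderiv, fderiv_modelFold]
    rintro ⟨h, hh⟩
    have := congrArg (fun v : EuclideanSpace ℝ (Fin 4) => v 0) hh
    simp [Alin, e0] at this

end ModelFold

/-! ### No definition leak at `k = 0` (PROVED): the round sphere is in pleat-free position -/

/-- `proj5` is linear: the bundled continuous linear map, `⇑proj5L = proj5` by `rfl`. [folklore] -/
def proj5L : EuclideanSpace ℝ (Fin 5) →L[ℝ] EuclideanSpace ℝ (Fin 4) :=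
  LinearMap.toContinuousLinearMap
    { toFun := proj5
      map_add' := fun p q => by
        ext i
        fin_cases i <;> simp [proj5]
      map_smul' := fun c p => by
        ext i
        fin_cases i <;> simp [proj5] }

/-- `proj5L` is `proj5` pointwise. -/
@[simp] theorem proj5L_apply (p : EuclideanSpace ℝ (Fin 5)) : proj5L p = proj5 p := rfl

/-- `proj5L` coerces to `proj5`. -/
theorem coe_proj5L : (proj5L : EuclideanSpace ℝ (Fin 5) → EuclideanSpace ℝ (Fin 4)) = proj5 := rfl

/-- A vector killed by the shadow is vertical: all its coordinates but `p 4` vanish. [folklore] -/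
theorem apply_eq_zero_of_proj5_eq_zero {w : EuclideanSpace ℝ (Fin 5)} (hw : proj5 w = 0) (i : Fin 5)
    (hi : i ≠ 4) : w i = 0 := by
  have h := fun j : Fin 4 => congrArg (fun v : EuclideanSpace ℝ (Fin 4) => v j) hw
  fin_cases i
  · simpa [proj5] using h 0
  · simpa [proj5] using h 1
  · simpa [proj5] using h 2
  · simpa [proj5] using h 3
  · exact absurd rfl hi

/-- `finrank ℝ ℝ⁵ = 4 + 1`, the `Fact` Mathlib's sphere instances key on. -/
instance factFinrankFive : Fact (Module.finrank ℝ (EuclideanSpace ℝ (Fin 5)) = 4 + 1) :=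
  ⟨by simp⟩

/-- **Off the equator the shadow of the round sphere is an immersion**: at `m ∈ S⁴` with
`m 4 ≠ 0` the differential of `proj5 ∘ (↑)` is injective (a tangent vector `⊥ m` killed by the
shadow is vertical, and `⟪m, w⟫ = m₄ w₄ = 0` forces `w = 0`).  Ported verbatim from the disprover's
certificate (Disproof.lean §7c). [folklore] -/
theorem injective_mfderiv_shadow_sphere (m : Metric.sphere (0 : EuclideanSpace ℝ (Fin 5)) 1)
    (hm : (m : EuclideanSpace ℝ (Fin 5)) 4 ≠ 0) :
    Function.Injective (mfderiv (𝓡 4) (𝓡 4)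
      (proj5 ∘ (Subtype.val : Metric.sphere (0 : EuclideanSpace ℝ (Fin 5)) 1 → EuclideanSpace ℝ (Fin 5)))
      m) := by
  -- chain rule: d(proj5 ∘ val) = proj5L ∘ d(val)
  have hsmooth : ContMDiff (𝓡 4) 𝓘(ℝ, EuclideanSpace ℝ (Fin 5)) ∞
      (Subtype.val : Metric.sphere (0 : EuclideanSpace ℝ (Fin 5)) 1 → EuclideanSpace ℝ (Fin 5)) :=
    contMDiff_coe_sphere
  have hval : HasMFDerivAt (𝓡 4) 𝓘(ℝ, EuclideanSpace ℝ (Fin 5))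
      (Subtype.val : Metric.sphere (0 : EuclideanSpace ℝ (Fin 5)) 1 → EuclideanSpace ℝ (Fin 5)) m
      (mfderiv (𝓡 4) 𝓘(ℝ, EuclideanSpace ℝ (Fin 5))
        (Subtype.val : Metric.sphere (0 : EuclideanSpace ℝ (Fin 5)) 1 → EuclideanSpace ℝ (Fin 5)) m) :=
    ((hsmooth m).mdifferentiableAt (by simp)).hasMFDerivAt
  have hproj : HasMFDerivAt 𝓘(ℝ, EuclideanSpace ℝ (Fin 5)) 𝓘(ℝ, EuclideanSpace ℝ (Fin 4))
      (proj5L : EuclideanSpace ℝ (Fin 5) → EuclideanSpace ℝ (Fin 4))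
      ((Subtype.val : Metric.sphere (0 : EuclideanSpace ℝ (Fin 5)) 1 → EuclideanSpace ℝ (Fin 5)) m)
      proj5L :=
    proj5L.hasMFDerivAt
  have hcomp := hproj.comp m hval
  have heq : mfderiv (𝓡 4) (𝓡 4)
      (proj5 ∘ (Subtype.val : Metric.sphere (0 : EuclideanSpace ℝ (Fin 5)) 1 → EuclideanSpace ℝ (Fin 5)))
        m =
      (proj5L : EuclideanSpace ℝ (Fin 5) →L[ℝ] EuclideanSpace ℝ (Fin 4)).comp
        (mfderiv (𝓡 4) 𝓘(ℝ, EuclideanSpace ℝ (Fin 5))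
          (Subtype.val : Metric.sphere (0 : EuclideanSpace ℝ (Fin 5)) 1 → EuclideanSpace ℝ (Fin 5)) m) := by
    rw [← coe_proj5L]
    exact hcomp.mfderiv
  rw [heq]
  intro v₁ v₂ h
  apply mfderiv_coe_sphere_injective (n := 4) (E := EuclideanSpace ℝ (Fin 5)) m
  -- a vector of `ℝ⁵` which is tangent to the sphere at `m` (`⊥ m`) and vertical is zero
  have key : ∀ w : EuclideanSpace ℝ (Fin 5),
      w ∈ (ℝ ∙ ((m : Metric.sphere (0 : EuclideanSpace ℝ (Fin 5)) 1) : EuclideanSpace ℝ (Fin 5)))ᗮ →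
        proj5 w = 0 → w = 0 := by
    intro w hw hpw
    have hcoords := apply_eq_zero_of_proj5_eq_zero hpw
    rw [Submodule.mem_orthogonal_singleton_iff_inner_right, PiLp.inner_apply,
      Fin.sum_univ_five] at hw
    simp [hcoords 0 (by decide), hcoords 1 (by decide), hcoords 2 (by decide),
      hcoords 3 (by decide), hm] at hw
    ext i
    fin_cases i
    · simpa using hcoords 0 (by decide)
    · simpa using hcoords 1 (by decide)
    · simpa using hcoords 2 (by decide)
    · simpa using hcoords 3 (by decide)
    · simpa using hw
  have hr := range_mfderiv_coe_sphere (n := 4) m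
  have hv : ∀ v, (mfderiv (𝓡 4) 𝓘(ℝ, EuclideanSpace ℝ (Fin 5))
      (Subtype.val : Metric.sphere (0 : EuclideanSpace ℝ (Fin 5)) 1 → EuclideanSpace ℝ (Fin 5)) m v :
        EuclideanSpace ℝ (Fin 5)) ∈
      (ℝ ∙ ((m : Metric.sphere (0 : EuclideanSpace ℝ (Fin 5)) 1) : EuclideanSpace ℝ (Fin 5)))ᗮ := by
    intro v
    rw [← hr]
    exact ⟨v, rfl⟩
  have hsub := key _ (Submodule.sub_mem _ (hv v₁) (hv v₂)) ?_
  · exact sub_eq_zero.mp hsub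
  · have h' : proj5L (mfderiv (𝓡 4) 𝓘(ℝ, EuclideanSpace ℝ (Fin 5))
        (Subtype.val : Metric.sphere (0 : EuclideanSpace ℝ (Fin 5)) 1 → EuclideanSpace ℝ (Fin 5)) m v₁) =
        proj5L (mfderiv (𝓡 4) 𝓘(ℝ, EuclideanSpace ℝ (Fin 5))
          (Subtype.val : Metric.sphere (0 : EuclideanSpace ℝ (Fin 5)) 1 → EuclideanSpace ℝ (Fin 5)) m v₂) := h
    rw [← proj5L_apply, map_sub, h', sub_self]

/-- **No definition leak at `k = 0` — the round sphere IS in pleat-free position** (the skeleton's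
refuter test `RoundSphereIsPleatFree`): `ι` the inclusion (a smooth embedding by Hirsch's criterion
`Literature.Topology.FourManifolds.isSmoothEmbedding_of_injective_of_injective_mfderiv`), `δ = 1/2`,
no pleat charts, and the shadow immersive above height `1/2` by `injective_mfderiv_shadow_sphere`.
Ported from the disprover's proof for a verbatim copy (Disproof.lean §7c). [folklore] -/
theorem hasPleatedPosition_sphere_zero :
    HasPleatedPosition (Metric.sphere (0 : EuclideanSpace ℝ (Fin 5)) 1) 0 := by
  refine ⟨Subtype.val, 1 / 2, Fin.elim0, ?_, by norm_num, by norm_num, ?_, ?_, ?_, ?_, ?_⟩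
  · exact Literature.Topology.FourManifolds.isSmoothEmbedding_of_injective_of_injective_mfderiv
      (contMDiff_coe_sphere (n := 4) (E := EuclideanSpace ℝ (Fin 5))) (by simp) Subtype.val_injective
      fun v => mfderiv_coe_sphere_injective (n := 4) (E := EuclideanSpace ℝ (Fin 5)) v
  · rw [Subtype.range_coe]
  · exact fun j => j.elim0
  · exact fun j => j.elim0
  · intro m hm _
    exact injective_mfderiv_shadow_sphere m (by intro h0; rw [h0] at hm; norm_num at hm)
  · exact fun j => j.elim0

/-- Bookkeeping: a pleat-free position is a pleated position for `k = 0`, so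
`∃ k, HasPleatedPosition S⁴ k` (the `M = S⁴` instance of the conclusion of `stub_roundRimNormalForm`).
[folklore] -/
theorem exists_hasPleatedPosition_sphere :
    ∃ k, HasPleatedPosition (Metric.sphere (0 : EuclideanSpace ℝ (Fin 5)) 1) k :=
  ⟨0, hasPleatedPosition_sphere_zero⟩

end Summit.SmoothPoincare4.SmoothPoincare4.Theorems.OrigamiFoldExistence.ShadowPleats

end
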